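import Literature.MathematicalPhysics.QuantumFieldTheory.Balaban1983to89.B8Real123CubeMemberRec
import Literature.MathematicalPhysics.QuantumFieldTheory.Balaban1983to89.B8Eq191FlatTowerGramRec
import Literature.MathematicalPhysics.QuantumFieldTheory.Balaban1983to89.B8Eq191FlatLettersDentedCubeMemberRec

/-!
# `Balaban1983to89.B8LandauRestoringLinearRec` — [Balaban1985RegularSpaces] (1.96)–(1.101) AT `U₀ = 1` FOR THE RECORD's CENTRED TOWER: THE LINEAR LANDAU-RESTORING CORRECTION
# WITH PRESCRIBED RESTRICTION DATA — `μ = H′(1)X`, `Q′μ = X` EXACTLY («Q′H′ = I», p. 96), supported in `Ω′₀`, with the (1.101) bounds `|μ|, (Lʲη)|∂^ημ| ≤ B′₀ᴴ·|X|`,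
# `(Lʲη)²|Δ^ημ| ≤ B′₂·|X|` — item (ii-a) of director-ym №310's branch (ii) «`u_sym = u_rad·exp(iη·H̃c)`», block datum `X` ABSTRACT

statement-level skeleton of published theorems with citation tags; proofs where landed; nothing here is a claim about the Yang–Mills mass gap

CITATION HEADER (lean-in-tree rule).  Cell `pub-ymgap` (HUMAN RULING D-0062), «N05-REC» road; plan g93 A3⁵ «ρ3 φ-form» ∕ (Q-φ) re-opened on the junction half (dag-n05-e correctness note
2026-08-29T20:00Z: row 8 = the EXACT multiplier-form Landau identity does not transport under a site-dependent gauge change) ∕ director-ym №310 RULING: branch (ii) «Landau-restoring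
correction» — (ii-a) datum + LINEAR SOLVE `μ_lin = H′(1)·c` on the flat letters (THIS FILE, `c` = `X` abstract block data), (ii-b) Sect.-E contraction with one source slot, (ii-c) rows
1–7∕(T2b) for `fixed′`.  Pen dag-n05-e g41.  [6] = [Balaban1985RegularSpaces] (1.96)–(1.98) p. 92, (1.101) p. 93, p. 96 («Q′H′ = I»), (1.135)–(1.138) p. 99; [4] =
[Balaban1985BackgroundPropagators] Thm 3.2 (3.48) p. 398, (3.23)–(3.25) p. 394; [15] = [Balaban1985Variational] (148)–(152) p. 301; [I] = [Balaban1987RG1] (0.3) p. 252, (0.11) p. 253.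
`--kind proof --supports stmt-QuantumFields-20541` (K0⁷; count-neutral; no definition).
REUSED BY NAME: `B8Real123FlatTranslateRec.Real123Block` (the three REAL families — REAL-2 = (1.101) for `H′ = T⁻¹T⁻¹Qᵀ(QT⁻²Qᵀ)⁻¹`), `B8Real123CubeMemberRec.{Real123DentedCubeMemberPrintedZ,
real123DentedCubeMemberPrintedZ_holds}` (UNCONDITIONAL at the dented record member, this lineage g31∕g32∕g38), `B8Eq191FlatTowerGramRec.isUnit_towerGramZ` (`QT⁻²Qᵀ` invertible),
`B8Eq191FlatLettersDentedCubeMemberRec.{tower_meets_dented, towers_disjoint_dented}`, `B8DentedCubeMemberZdRec.lamST_top_apply`, print's weights `B8Eq1101CubeMemberWeights.wPrinted`.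

THE MATHEMATICS (why this is the linear part of (ii)).  The radial crown's Landau transformation `u_c` solves [6] Prop. 6 for the radially-axial input with restriction data ZERO
(`Restr129Z … 1 u_c`); the sym-normalised representative wanted by `HThm4RecSym152` (row 9′ EXACT) is the solution of the SAME constrained problem with restriction data
`c = Q′(log g_sr)` (`g_sr` = radial→averaged axial-gauge transport, ‖g_sr − 1‖ = O(θ) by `B7StairLoopSmallnessRec` + a group-average closeness).  The Euler–Lagrange identity of the
constrained problem — row 8, [6] (1.38) in multiplier form — is the same for every constraint datum (the tangent space is `N(Q′)` in both cases), so rows 8 and 9′ are EXACT for the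
corrected solution; its LINEAR part in the datum is `μ_lin = H′(1)·c`, `H′(1) = G′(1)²Q′ᵀ(Q′G′(1)²Q′ᵀ)⁻¹` ([6] (1.96)–(1.98); kernel `T⁻¹T⁻¹Qᵀ(QT⁻²Qᵀ)⁻¹` of
`B8Eq191FlatLettersExplicitRec`), with `Q′μ_lin = c` EXACTLY and the (1.101) bounds.  The non-linear closure (ii-b) and the row transfer (ii-c) follow in separate files.

WHAT IS PROVED (sorry-free).  ★★ `restoringLinear_real` — for EVERY presentation `(S, B, K, T, Q)` of a site tower `{D_j}`, cells `{Λ_j}_{j ≤ n}` (centred labels `flmZ L`), weights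
`w ≥ 0`, whose cell towers meet `D₀` and are pairwise disjoint there, under the REAL families `Real123Block …` and for every block datum `X : B → ℝ` with `|X| ≤ s`: the function
`μ := H′X` (explicit kernel, extended by `0` off `D₀`) satisfies `Q μ = X` on EVERY cell of EVERY level (restriction data attained exactly), `|μ| ≤ B′₀ᴴ·s`,
`(Lʲη)|∂^ημ| ≤ B′₀ᴴ·s` on the sides touching `D_j`, `(Lʲη)²|Δ^ημ| ≤ B′₂·s` on `D_j`.  ★★★ `restoringLinear_real_dentedMember` — the same UNCONDITIONALLY at every dented record
cube datum `c : CubeB8DZ (d+1) (ℓ+1) K Ω` on print's p. 98 sub-lattice above threshold with the anchored dent premise (top truncation, cells `c.lamS`, weights `wPrinted`):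
constants `B′₀ᴴ > 0`, `B′₂ ≥ 0` and thresholds from `real123DentedCubeMemberPrintedZ_holds` (`B_G`, `B_R` not displayed: REAL-1∕3 are not read here).
HONEST SCOPE.  Finite linear algebra + by-name use of the PROVED (1.101) family; scalar (real) form — the `𝔸`-valued `⊗ id` reading and the non-linear closure are (ii-b); NO new
estimate of Bałaban's; branch (ii) = «standard perturbative re-normalisation to another admissible restriction datum with print's own operators — variant, our proof» (№310's licence
line); `HThm4Rec*` CONDITIONAL; N05 DISCHARGED OF RECORD since R467 (count-neutral record-level work), N07 NOT discharged; counts unmoved (typed 28∕28 · discharged 8∕28); one finite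
𝕋⁴ programme at fixed ε, `G = SU(2)` of record — nothing continuum ∕ ℝ⁴ ∕ OS ∕ mass gap ∕ Clay.  No `def`, no `instance`, no `notation`, no `sorry`.
-/

set_option autoImplicit false

noncomputable section

open scoped BigOperators Matrix

namespace Literature.MathematicalPhysics.QuantumFieldTheory.Balaban1983to89.B8LandauRestoringLinearRec

open B7Prop1Explicit (e)
open B8Eq140Level (SideTouches)
open B8LambdaSpaceKLevel (wt)
open B8Eq119TwistedAxialRec (flmZ)
open B8Real123FlatTranslateRec (Real123Block)
open B8Real123CubeMemberRec (Real123DentedCubeMemberPrintedZ real123DentedCubeMemberPrintedZ_holds)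
open B8Eq191FlatTowerGramRec (isUnit_towerGramZ)
open B8Eq191FlatLettersDentedCubeMemberRec (tower_meets_dented towers_disjoint_dented)
open B8DentedCubeMemberZdRec (lamST_top_apply)
open B8Eq1101CubeMemberWeights (wPrinted)
open BlockAveragingZd (ctrShift)
open Literature.MathematicalPhysics.QuantumLattice (blockMap)
open Node00 (CubeB8DZ)

variable {d : ℕ}

/-! ## §1  The linear correction with prescribed restriction data, for every presentation of a tower -/

open Classical in
/-- ★★ **THE LINEAR LANDAU-RESTORING CORRECTION WITH PRESCRIBED RESTRICTION DATA, `μ = H′(1)X`** ([6] (1.96)–(1.98), «Q′H′ = I» p. 96, (1.101)): for every presentation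
`(S, B, K, T, Q)` of a site tower `{D_j}` with cells `{Λ_j}_{j ≤ n}` (centred labels `flmZ L`, [I] (0.3)) and weights `w ≥ 0`, whose cell towers meet `D₀` and are pairwise disjoint
there, under the REAL families of the flat p6 consumer and for every block datum `X` on the cells with `|X| ≤ s`, the function `μ := T⁻¹T⁻¹Qᵀ(QT⁻²Qᵀ)⁻¹X` (extended by `0`
off `D₀`) ATTAINS THE DATA EXACTLY — `Σ_z Q(p,z)μ(z) = X(p)` at every cell `p` of every level — and obeys (1.101): `|μ| ≤ B′₀ᴴ·s`, `(Lʲη)|∂^ημ| ≤ B′₀ᴴ·s` on the sides touching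
`D_j`, `(Lʲη)²|Δ^ημ| ≤ B′₂·s` on `D_j`.  (Linear part of director-ym №310's branch (ii): the corrected Landau transformation's gauge parameter to first order in the datum.)
[cite: Balaban1985RegularSpaces, (1.96)–(1.98) p.92, (1.101) p.93, p.96, (1.135)–(1.138) p.99; Balaban1985BackgroundPropagators, Theorem 3.2 (3.48) p.398, (3.23)–(3.25) p.394; Balaban1987RG1, (0.3) p.252] -/
theorem restoringLinear_real (hd : 0 < d) {η : ℝ} (hη : η ≠ 0) {L : ℕ} (hL : 1 ≤ L) (n : ℕ) (Λ D : ℕ → Set (Fin d → ℤ))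
    (w : ℕ → ℝ) (hw : ∀ j, 0 ≤ w j) {BG B₀'H B₂' BR : ℝ} (hR : Real123Block L (flmZ L) η n w D Λ BG B₀'H B₂' BR)
    (S : Finset (Fin d → ℤ)) (hS : ∀ z, z ∈ S ↔ z ∈ D 0)
    (B : Finset (ℕ × (Fin d → ℤ))) (hB : ∀ p, p ∈ B ↔ p.1 ≤ n ∧ p.2 ∈ Λ p.1)
    (hmeet : ∀ p ∈ B, ∃ z ∈ S, flmZ L p.1 z = p.2)
    (hdisj : ∀ p ∈ B, ∀ p' ∈ B, ∀ z ∈ S, flmZ L p.1 z = p.2 → flmZ L p'.1 z = p'.2 → p = p')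
    (K : (Fin d → ℤ) → (Fin d → ℤ) → ℝ)
    (hK : ∀ x z, K x z = ((η ^ 2)⁻¹ * ∑ μ : Fin d, ((2 : ℝ) * (if z = x then (1 : ℝ) else 0) - (if z = x + e μ then (1 : ℝ) else 0)
      - (if z = x - e μ then (1 : ℝ) else 0))) +
      (∑ j ∈ Finset.range (n + 1), (if flmZ L j x ∈ Λ j ∧ flmZ L j z = flmZ L j x then
        w j * ((((L : ℝ) ^ d)⁻¹) ^ j) ^ 2 else 0)))
    (T : Matrix ↥S ↥S ℝ) (hT : T = Matrix.of fun x z : ↥S => K x.1 z.1)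
    (Q : Matrix ↥B ↥S ℝ) (hQ : Q = Matrix.of fun (p : ↥B) (z : ↥S) => if flmZ L p.1.1 z.1 = p.1.2 then (((L : ℝ) ^ d)⁻¹) ^ p.1.1 else 0)
    (X : ↥B → ℝ) (s : ℝ) (hs : 0 ≤ s) (hX : ∀ p', |X p'| ≤ s) :
    ∃ μ : (Fin d → ℤ) → ℝ,
      (∀ x, x ∉ D 0 → μ x = 0) ∧
      (∀ v : ↥S, μ v.1 = ∑ p' : ↥B, (T⁻¹ * (T⁻¹ * Qᵀ) * (Q * T⁻¹ * T⁻¹ * Qᵀ)⁻¹) v p' * X p') ∧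
      (∀ p : ↥B, ∑ z : ↥S, Q p z * μ z.1 = X p) ∧
      (∀ x, |μ x| ≤ B₀'H * s) ∧
      (∀ j, j ≤ n → ∀ p ∈ {b : (Fin d → ℤ) × Fin d | SideTouches (D j) b.1 b.2},
        wt L η j * |η⁻¹ * (μ (p.1 + e p.2) - μ p.1)| ≤ B₀'H * s) ∧
      (∀ j, j ≤ n → ∀ x ∈ D j,
        wt L η j ^ 2 * |∑ ν : Fin d, (η ^ 2)⁻¹ * (2 * μ x - μ (x + e ν) - μ (x - e ν))| ≤ B₂' * s) := by
  set N : Matrix ↥S ↥B ℝ := T⁻¹ * (T⁻¹ * Qᵀ) * (Q * T⁻¹ * T⁻¹ * Qᵀ)⁻¹ with hN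
  let μ : (Fin d → ℤ) → ℝ := fun x => if hx : x ∈ S then ∑ p' : ↥B, N ⟨x, hx⟩ p' * X p' else 0
  have hsupp : ∀ x, x ∉ D 0 → μ x = 0 := by
    intro x hx
    have hxS : x ∉ S := fun h => hx ((hS x).1 h)
    simp only [μ, dif_neg hxS]
  have hform : ∀ v : ↥S, μ v.1 = ∑ p' : ↥B, N v p' * X p' := by
    intro v
    simp only [μ, dif_pos v.2]
  -- the tower Gram matrix is invertible, so `Q·N = 1`
  have hM : IsUnit (Q * T⁻¹ * T⁻¹ * Qᵀ) := by
    rw [hQ, hT]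
    exact isUnit_towerGramZ hd hη hL n Λ w hw K hK S B hmeet hdisj
  have hQN : Q * N = 1 := by
    have hassoc : Q * N = (Q * T⁻¹ * T⁻¹ * Qᵀ) * (Q * T⁻¹ * T⁻¹ * Qᵀ)⁻¹ := by
      rw [hN]; simp only [Matrix.mul_assoc]
    rw [hassoc]
    exact Matrix.mul_nonsing_inv _ ((Matrix.isUnit_iff_isUnit_det _).mp hM)
  have hQμ : ∀ p : ↥B, ∑ z : ↥S, Q p z * μ z.1 = X p := by
    intro p
    calc ∑ z : ↥S, Q p z * μ z.1 = ∑ z : ↥S, Q p z * ∑ p' : ↥B, N z p' * X p' := by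
          refine Finset.sum_congr rfl fun z _ => ?_
          rw [hform z]
      _ = ∑ p' : ↥B, (Q * N) p p' * X p' := by
          simp only [Matrix.mul_apply, Finset.mul_sum, Finset.sum_mul, mul_assoc]
          rw [Finset.sum_comm]
      _ = X p := by
          rw [hQN]
          simp [Matrix.one_apply]
  have hb := (hR S hS B hB K hK T hT Q hQ).2.1 X s hs hX μ hsupp hform
  exact ⟨μ, hsupp, hform, hQμ, hb.1, hb.2.1, hb.2.2⟩

/-! ## §2  At every dented record cube member (top truncation), unconditionally -/

open Classical in
/-- ★★★ **THE LINEAR LANDAU-RESTORING CORRECTION AT EVERY DENTED RECORD CUBE MEMBER, UNCONDITIONALLY** ([6] (1.96)–(1.101) on the dented tower `{Ω′_j}` of [15] (148)–(150), top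
truncation; constants from `real123DentedCubeMemberPrintedZ_holds`): there are `B′₀ᴴ > 0`, `B′₂ ≥ 0` and thresholds `ρ₀, M₀, N₀` such that for every `η > 0`, `M_h ≥ 3` with
`M₀ ≤ L·M_h`, every dented record cube datum `c` on print's p. 98 sub-lattice above threshold with the anchored dent premise, every presentation `(S, B, K, T, Q)` of its tower `c.sq`
with cells `c.lamS` and print's weights, and every block datum `X` with `|X| ≤ s`: `μ := H′(1)X` attains `X` exactly on every cell and obeys the three (1.101) bounds.  This is
(ii-a)'s linear solve where the junction needs it; the datum `X` (N07's `c`: the restriction data of the radial→averaged axial transport) plugs in by name.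
[cite: Balaban1985RegularSpaces, (1.96)–(1.98) p.92, (1.101) p.93, p.96, p.98, (1.135)–(1.138) p.99; Balaban1985Variational, (148)–(152) p.301; Balaban1985BackgroundPropagators, Theorem 3.2 (3.48) p.398; Balaban1987RG1, (0.3) p.252, (0.11) p.253] -/
theorem restoringLinear_real_dentedMember (d ℓ : ℕ) (hℓ : 1 ≤ ℓ) (hodd : Odd (ℓ + 1)) :
    ∃ B₀'H B₂' ρ₀ M₀ : ℝ, ∃ N₀ : ℕ, 0 < B₀'H ∧ 0 ≤ B₂' ∧
      ∀ (η : ℝ), 0 < η → ∀ (Mh : ℕ), 3 ≤ Mh → M₀ ≤ ((ℓ : ℝ) + 1) * Mh →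
      ∀ (K' : ℕ) (Ω : ℕ → Set (Fin (d + 1) → ℤ)) (c : CubeB8DZ (d + 1) (ℓ + 1) K' Ω) (R : ℕ),
        Mh * (ℓ + 1) ∣ c.ρ → Mh * (ℓ + 1) ∣ c.M → R * (Mh * (ℓ + 1)) ≤ c.ρ → 2 * (ℓ + 1) ≤ R → N₀ + 1 ≤ R * ((ℓ + 1) * Mh) → ρ₀ ≤ (c.ρ : ℝ) →
        (∀ x y : Fin (d + 1) → ℤ,
            blockMap (Mh * (ℓ + 1) ^ (c.k + 1)) (x - fun i => (((ℓ + 1 : ℕ) : ℤ)) ^ c.k * (c.a i - c.ρ) - (ctrShift (ℓ + 1) c.k : ℤ)) =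
              blockMap (Mh * (ℓ + 1) ^ (c.k + 1)) (y - fun i => (((ℓ + 1 : ℕ) : ℤ)) ^ c.k * (c.a i - c.ρ) - (ctrShift (ℓ + 1) c.k : ℤ)) →
            x ∈ Ω c.k → y ∈ Ω c.k) →
        ∀ (S : Finset (Fin (d + 1) → ℤ)) (_ : ∀ z, z ∈ S ↔ z ∈ c.sq 0)
          (B : Finset (ℕ × (Fin (d + 1) → ℤ))) (_ : ∀ p, p ∈ B ↔ p.1 ≤ c.k ∧ p.2 ∈ c.lamS p.1)
          (K : (Fin (d + 1) → ℤ) → (Fin (d + 1) → ℤ) → ℝ)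
          (_ : ∀ x z, K x z = ((η ^ 2)⁻¹ * ∑ μ : Fin (d + 1), ((2 : ℝ) * (if z = x then (1 : ℝ) else 0) - (if z = x + e μ then (1 : ℝ) else 0)
            - (if z = x - e μ then (1 : ℝ) else 0))) +
            (∑ j ∈ Finset.range (c.k + 1), (if flmZ (ℓ + 1) j x ∈ c.lamS j ∧ flmZ (ℓ + 1) j z = flmZ (ℓ + 1) j x then
              wPrinted d ℓ η j * (((((ℓ : ℝ) + 1) ^ (d + 1))⁻¹) ^ j) ^ 2 else 0)))
          (T : Matrix ↥S ↥S ℝ) (_ : T = Matrix.of fun x z : ↥S => K x.1 z.1)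
          (Q : Matrix ↥B ↥S ℝ) (_ : Q = Matrix.of fun (p : ↥B) (z : ↥S) =>
            if flmZ (ℓ + 1) p.1.1 z.1 = p.1.2 then ((((ℓ : ℝ) + 1) ^ (d + 1))⁻¹) ^ p.1.1 else 0)
          (X : ↥B → ℝ) (s : ℝ), 0 ≤ s → (∀ p', |X p'| ≤ s) →
        ∃ μ : (Fin (d + 1) → ℤ) → ℝ,
          (∀ x, x ∉ c.sq 0 → μ x = 0) ∧
          (∀ v : ↥S, μ v.1 = ∑ p' : ↥B, (T⁻¹ * (T⁻¹ * Qᵀ) * (Q * T⁻¹ * T⁻¹ * Qᵀ)⁻¹) v p' * X p') ∧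
          (∀ p : ↥B, ∑ z : ↥S, Q p z * μ z.1 = X p) ∧
          (∀ x, |μ x| ≤ B₀'H * s) ∧
          (∀ j, j ≤ c.k → ∀ p ∈ {b : (Fin (d + 1) → ℤ) × Fin (d + 1) | SideTouches (c.sq j) b.1 b.2},
            wt (ℓ + 1) η j * |η⁻¹ * (μ (p.1 + e p.2) - μ p.1)| ≤ B₀'H * s) ∧
          (∀ j, j ≤ c.k → ∀ x ∈ c.sq j,
            wt (ℓ + 1) η j ^ 2 * |∑ ν : Fin (d + 1), (η ^ 2)⁻¹ * (2 * μ x - μ (x + e ν) - μ (x - e ν))| ≤ B₂' * s) := by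
  obtain ⟨BG, B₀'H, B₂', BR, ρ₀, M₀, N₀, hBG, hB₀'H, hB₂', hBR, H⟩ := real123DentedCubeMemberPrintedZ_holds d ℓ hℓ hodd
  refine ⟨B₀'H, B₂', ρ₀, M₀, N₀, hB₀'H, hB₂', ?_⟩
  intro η hη Mh hMh hM0 K' Ω c R hρdiv hMdiv hRρ h2R hN01 hρ0 hΩ S hS B hB K hK T hT Q hQ X s hs hX
  have hR : Real123Block (ℓ + 1) (flmZ (ℓ + 1)) η c.k (wPrinted d ℓ η) c.sq c.lamS BG B₀'H B₂' BR :=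
    H η hη Mh hMh hM0 K' Ω c R hρdiv hMdiv hRρ h2R hN01 hρ0 hΩ
  have hd : 0 < d + 1 := Nat.succ_pos d
  have hL : 1 ≤ ℓ + 1 := by omega
  have hw : ∀ j, 0 ≤ wPrinted d ℓ η j := by
    obtain ⟨hwpos, -, -⟩ := B8Eq1101CubeMemberWeights.wPrinted_facts d hℓ hη
    exact fun j => (hwpos j).le
  -- the cell towers meet `Ω′₀` and are pairwise disjoint there (top truncation: `lamST c.k = lamS`)
  have hmeet : ∀ p ∈ B, ∃ z ∈ S, flmZ (ℓ + 1) p.1 z = p.2 := by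
    intro p hp
    obtain ⟨hj, hy⟩ := (hB p).1 hp
    rw [← lamST_top_apply c p.1] at hy
    obtain ⟨z, hz, hzy⟩ := tower_meets_dented c hodd le_rfl p.1 hj p.2 hy
    exact ⟨z, (hS z).2 hz, hzy⟩
  have hdisj : ∀ p ∈ B, ∀ p' ∈ B, ∀ z ∈ S, flmZ (ℓ + 1) p.1 z = p.2 → flmZ (ℓ + 1) p'.1 z = p'.2 → p = p' := by
    intro p hp p' hp' z hz h1 h2
    obtain ⟨hj, hy⟩ := (hB p).1 hp
    obtain ⟨hj', hy'⟩ := (hB p').1 hp'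
    rw [← lamST_top_apply c p.1] at hy
    rw [← lamST_top_apply c p'.1] at hy'
    obtain ⟨hjj, hyy⟩ := towers_disjoint_dented c hodd le_rfl p.1 hj p'.1 hj' p.2 hy p'.2 hy' z ((hS z).1 hz) h1 h2
    exact Prod.ext hjj hyy
  have hLr : (((ℓ + 1 : ℕ) : ℝ)) = (ℓ : ℝ) + 1 := by push_cast; ring
  have hK' : ∀ x z, K x z = ((η ^ 2)⁻¹ * ∑ μ : Fin (d + 1), ((2 : ℝ) * (if z = x then (1 : ℝ) else 0) - (if z = x + e μ then (1 : ℝ) else 0)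
      - (if z = x - e μ then (1 : ℝ) else 0))) +
      (∑ j ∈ Finset.range (c.k + 1), (if flmZ (ℓ + 1) j x ∈ c.lamS j ∧ flmZ (ℓ + 1) j z = flmZ (ℓ + 1) j x then
        wPrinted d ℓ η j * (((((ℓ + 1 : ℕ) : ℝ) ^ (d + 1))⁻¹) ^ j) ^ 2 else 0)) := by
    intro x z; rw [hK x z, hLr]
  have hQ' : Q = Matrix.of fun (p : ↥B) (z : ↥S) =>
      if flmZ (ℓ + 1) p.1.1 z.1 = p.1.2 then (((((ℓ + 1 : ℕ) : ℝ)) ^ (d + 1))⁻¹) ^ p.1.1 else 0 := by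
    rw [hQ, hLr]
  exact restoringLinear_real hd hη.ne' hL c.k c.lamS c.sq (wPrinted d ℓ η) hw hR S hS B hB hmeet hdisj K hK' T hT Q hQ' X s hs hX

end Literature.MathematicalPhysics.QuantumFieldTheory.Balaban1983to89.B8LandauRestoringLinearRec
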